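import Mathlib
import Summits.Ventures.HodgeRepro.Tier4.Common.LocalUnitary
import Summits.Ventures.HodgeRepro.Tier4.Line1.RTFSetting
import Summits.Ventures.HodgeRepro.Tier4.Line4.D3Coeff

/-!
# Tier4/Line4/D3CoeffUnitary — C-L4-D3COEFF: the coefficient on `U(1,1)` — continuity, the bound `‖D3coeff‖ ≤ 1`, and
`D3coeff g⁻¹ = conj (D3coeff g)` (the unitary relation of typer-2's `Common/LocalUnitary`)

Blind re-derivation cell `pub-hodge-repro`, Tier 4 (README §9–§10), seat t4-L1-p5 (prover, gen 4; cut C-L4-D3COEFF,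
lead (R-8) S14747; kernel shape S14811 (1)).  Target tree path `lean/Summits/Ventures/HodgeRepro/Tier4/Line4/D3CoeffUnitary.lean`.
The companion of `Line4/D3Coeff` (the definition and the torus equivariance laws, on `Common/LocalCoordinates` alone);
here the facts that need the unitary relation `locMat g · J · (locMat g)ᴴ = J` of `Common/LocalUnitary`
(`locEntry_zero_zero_ne_zero`, `one_le_norm_locEntry_zero_zero`, `locEntry_inv_zero_zero`) under the signature
hypotheses of the seesaw plane (`0 < a_w`, `(εb)_w < 0`: the `w`-block is in `U(1,1)`); no printed input.

* `continuous_D3coeff` — `α ≠ 0` on `U(1,1)`, so `α⁻¹ ^ 3` is continuous;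
* `norm_D3coeff_le_one` — `|α| ≥ 1` on `U(1,1)`, so `‖D3coeff g‖ ≤ 1` (the decay in `|α|` of the coefficient);
* `D3coeff_inv`, `refl_D3coeff_eq_cj` — `α(g⁻¹) = conj α(g)`, so `D3coeff g⁻¹ = conj (D3coeff g)`: `RTF.refl` of the
  coefficient is its `RTF.cj` (the coefficient of a unitary representation).

Nothing here says anything about the status of the Hodge conjecture for CM abelian varieties, which is NOT proved
(HC_CM is NOT proved by anyone in this repository).
-/

set_option autoImplicit false

noncomputable section

namespace Summit.Ventures.HodgeRepro.Tier4.Line4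

open Summit.Ventures.HodgeRepro.Tier4.Common Summit.Ventures.HodgeRepro.Tier4.Line1 NumberField Matrix

open scoped ComplexConjugate

section D3Unitary

variable {k : Type} [Field k] [NumberField k] (q : QuadData k) (a b ε : k) (w : InfinitePlace k)

/-- continuity of the coefficient on `U(1,1)` (`α ≠ 0` under the signature hypotheses). -/
theorem continuous_D3coeff (hw : w.IsReal) (hcm : IsCMAt q w) (hq : 4 * q.n - q.t ^ 2 ≠ 0)
    (ha : 0 < (adToC w (algebraMap k (Ad k) a)).re) (hb : (adToC w (algebraMap k (Ad k) (ε * b))).re < 0) :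
    Continuous (D3coeff q a b ε w) :=
  ((continuous_locEntry q a b ε w 0 0).inv₀ fun g => locEntry_zero_zero_ne_zero q a b ε w hw hcm hq ha hb g).pow 3

/-- the coefficient is bounded by `1` (`|α| ≥ 1` on `U(1,1)`). -/
theorem norm_D3coeff_le_one (hw : w.IsReal) (hcm : IsCMAt q w) (hq : 4 * q.n - q.t ^ 2 ≠ 0)
    (ha : 0 < (adToC w (algebraMap k (Ad k) a)).re) (hb : (adToC w (algebraMap k (Ad k) (ε * b))).re < 0)
    (g : GA (PlaneData.ofLinesRow q a b ε)) : ‖D3coeff q a b ε w g‖ ≤ 1 := by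
  unfold D3coeff
  rw [norm_pow, norm_inv]
  exact pow_le_one₀ (inv_nonneg.2 (norm_nonneg _))
    (inv_le_one_of_one_le₀ (one_le_norm_locEntry_zero_zero q a b ε w hw hcm hq ha hb g))

/-- the coefficient of the inverse is the conjugate (`α(g⁻¹) = conj α(g)`: the coefficient of a unitary
representation). -/
theorem D3coeff_inv (hw : w.IsReal) (hcm : IsCMAt q w) (hq : 4 * q.n - q.t ^ 2 ≠ 0)
    (ha : adToC w (algebraMap k (Ad k) a) ≠ 0) (g : GA (PlaneData.ofLinesRow q a b ε)) :
    D3coeff q a b ε w g⁻¹ = conj (D3coeff q a b ε w g) := by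
  unfold D3coeff
  rw [locEntry_inv_zero_zero q a b ε w hw hcm hq ha g, map_pow, map_inv₀]

/-- `refl` of the coefficient is its conjugate: `RTF.refl (D3coeff) = RTF.cj (D3coeff)`. -/
theorem refl_D3coeff_eq_cj (hw : w.IsReal) (hcm : IsCMAt q w) (hq : 4 * q.n - q.t ^ 2 ≠ 0)
    (ha : adToC w (algebraMap k (Ad k) a) ≠ 0) :
    RTF.refl (D3coeff q a b ε w) = RTF.cj (D3coeff q a b ε w) := by
  funext g
  exact D3coeff_inv q a b ε w hw hcm hq ha g

end D3Unitary

end Summit.Ventures.HodgeRepro.Tier4.Line4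

end
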